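import Mathlib
import Summits.Ventures.PercRepro2.HCov
import Summits.Ventures.PercRepro2.HCovSwap
import Summits.Ventures.PercRepro2.OddsLemma
import Summits.Ventures.PercRepro2.J1Regime
import Summits.Ventures.PercRepro2.RV
import Summits.Ventures.PercRepro2.SLevel

/-!
# The `S`-level signs and the regime mechanism of the (J1) line
(blind cell PercRepro2, typer-1 g9; continues `SLevel.lean` — ASSIGNMENTS v12.48, lead g24 INBOX 23:45:26Z)

Objects as in `SLevel.lean` (`hS`, `hS2`, `indS`, `slack`, `covS`, `phi`; `Q = {a₁ ↮ a₂}`, `S = C₁` revealed,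
`D = P(PD)`, `D_o = P(PD, o ∈ C₁ ∪ C₂)`).

* `harris_slack_nonneg`: `0 ≤ h_{bo}(S) − h_b(S) h_o(S)` (Harris in `G ∖ S`, `J1Regime.harris_del`);
  hence **`rvTable_of_covS_nonneg`: (SC) ⟹ (ii)** — `0 ≤ covS h_b φ` gives `J1RV.RVTable` through the
  decomposition `rvTableExpr_eq_slack_add_covS` (no (SC) `Prop` is declared; it waits for the engine twin).
* `covS_nonneg_of_monotone`: BHK06 Thm 1.3 on the revealed cluster `C₁` avoiding `a₂` (`bhk_induced`),
  cleared — `0 ≤ covS F₁ F₂` for increasing nonnegative `F₁, F₂`; `covS_neg_right`, `covS_one_sub_left`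
  (bilinearity; the constant `1` has zero covariance).
* The pointwise regime `D · h_o(S) ≤ D_o` for every `S ∋ a₃`: `−φ = e·(D_o − D h_o)` is increasing and
  nonnegative (`neg_phi_nonneg_of_regime`, `neg_phi_monotone_of_regime`), so
  **`covS_indS_phi_nonpos_of_regime`** ((i) at `S`-level: `Cov(incr, incr) ≥ 0`) and
  **`covS_hS_phi_nonneg_of_regime`** ((SC) at `S`-level: `Cov(decr, incr) ≤ 0` through `1 − h_b`), hence
  `rvTable_of_regime'` ((ii) in the regime, a second proof of `J1RV.rvTable_of_regime`) — the lead's «if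
  `h_o(S) ≤ γ` held on `{S ∋ a₃}`, (i) and (SC) would be immediate corollaries».
* The GOOD/BAD split on every instance (no regime): `φ = φᵇ − φᵍ` with `φᵍ = e·(D_o − D h_o)⁺` increasing
  and nonnegative, so `0 ≤ covS (1[b ∈ ·]) φᵍ` and `covS h_b φᵍ ≤ 0` are THEOREMS
  (`covS_indS_phiGood_nonneg`, `covS_hS_phiGood_nonpos`), and the open content of (i) / (SC) is exactly
  «the bad part is dominated by the good part» (`i_iff_bad_le_good`, `sc_iff_good_le_bad`) — the lead's
  sharpened mechanism question in the kernel.  Outside the regime nothing is claimed.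
-/

namespace Summit.Ventures.PercRepro2

open UnionCluster

namespace SLevel

section Signs

variable {V : Type*} {E : Type*} [Fintype E] [DecidableEq E] [Fintype V] [DecidableEq V]
  {R : Type*} [Field R] [LinearOrder R] [IsStrictOrderedRing R]

variable (p : E → R) (ends : E → Sym2 V) (o a₁ a₂ a₃ b : V)

local notation3 "Q" => avoidAll ends a₂ {a₁}
local notation3 "𝟙Q" => (avoidAll ends a₂ {a₁}).indicator (1 : Config E → R)
local notation3 "D" => prob p (PDEvent ends a₁ a₂ a₃)
local notation3 "Dₒ" => CovForm.Do p ends o a₁ a₂ a₃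

omit [Fintype V] [DecidableEq V] in
/-- `0 ≤ indS x S`. -/
lemma indS_nonneg (x : V) (S : Set V) : 0 ≤ (indS x S : R) :=
  Set.indicator_apply_nonneg fun _ => zero_le_one

omit [Fintype V] [DecidableEq V] in
/-- **Harris in `G ∖ S`**: `0 ≤ h_{bo}(S) − h_b(S) h_o(S)`. -/
theorem harris_slack_nonneg (hp : IsProbVec p) (S : Set V) : 0 ≤ slack p ends a₂ b o S := by
  unfold slack hS2 hS
  have h := J1Regime.harris_del p ends o a₂ b hp S
  rw [Set.inter_comm] at h
  linarith

omit [DecidableEq V] in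
/-- **(SC) ⟹ (ii)**: if `0 ≤ covS h_b φ` (the candidate strengthening `Cov_{S∼Q}(h_b, e·(h_o − γ)) ≥ 0`),
then `J1RV.RVTable` — the Harris term of `rvTableExpr_eq_slack_add_covS` is `≥ 0`. -/
theorem rvTable_of_covS_nonneg (hp : IsProbVec p)
    (h : 0 ≤ covS p ends a₁ a₂ (hS p ends a₂ b) (phi p ends o a₁ a₂ a₃)) :
    J1RV.RVTable p ends o a₁ a₂ a₃ b := by
  unfold J1RV.RVTable
  rw [rvTableExpr_eq_slack_add_covS]
  have hE : 0 ≤ expect p (fun ω => indS a₃ (cluster ends ω a₁) *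
      slack p ends a₂ b o (cluster ends ω a₁) * 𝟙Q ω) := by
    refine expect_nonneg hp fun ω => ?_
    exact mul_nonneg (mul_nonneg (indS_nonneg a₃ _) (harris_slack_nonneg p ends o a₂ b hp _))
      (Set.indicator_apply_nonneg fun _ => zero_le_one)
  have hD : 0 ≤ D := prob_nonneg hp _
  have hQ : 0 ≤ prob p Q := prob_nonneg hp _
  have := mul_nonneg (mul_nonneg hD hQ) hE
  linarith

end Signs

section Regime

variable {V : Type*} {E : Type*} [Fintype E] [DecidableEq E] [Fintype V] [DecidableEq V]
  {R : Type*} [Field R] [LinearOrder R] [IsStrictOrderedRing R]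

variable (p : E → R) (ends : E → Sym2 V) (o a₁ a₂ a₃ b : V)

local notation3 "Q" => avoidAll ends a₂ {a₁}
local notation3 "𝟙Q" => (avoidAll ends a₂ {a₁}).indicator (1 : Config E → R)
local notation3 "D" => prob p (PDEvent ends a₁ a₂ a₃)
local notation3 "Dₒ" => CovForm.Do p ends o a₁ a₂ a₃

omit [Fintype V] [DecidableEq V] in
/-- In the pointwise regime `D·h_o(S) ≤ D_o` for `S ∋ a₃`, `−φ = e·(D_o − D h_o)` is nonnegative. -/
lemma neg_phi_nonneg_of_regime (hreg : ∀ W : Set V, a₃ ∈ W → D * hS p ends a₂ o W ≤ Dₒ) (W : Set V) :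
    0 ≤ -phi p ends o a₁ a₂ a₃ W := by
  unfold phi indS
  by_cases hW : a₃ ∈ W
  · rw [Set.indicator_of_mem (show W ∈ {W : Set V | a₃ ∈ W} from hW)]
    simp only [Pi.one_apply, one_mul]
    linarith [hreg W hW]
  · rw [Set.indicator_of_notMem (show W ∉ {W : Set V | a₃ ∈ W} from hW), zero_mul, neg_zero]

omit [Fintype V] [DecidableEq V] in
/-- In the pointwise regime `−φ` is increasing (`h_o` is antitone, the indicator jumps upward to a
nonnegative value). -/
lemma neg_phi_monotone_of_regime (hp : IsProbVec p)
    (hreg : ∀ W : Set V, a₃ ∈ W → D * hS p ends a₂ o W ≤ Dₒ) :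
    Monotone (fun W => -phi p ends o a₁ a₂ a₃ W) := by
  have hgo : Antitone (hS p ends a₂ o) := delClusterProb_anti p hp ends a₂ (isUpperSet_mem_setOf o)
  have hD : 0 ≤ D := prob_nonneg hp _
  intro W W' hWW'
  by_cases hW : a₃ ∈ W
  · have hW' : a₃ ∈ W' := hWW' hW
    simp only [phi, indS]
    rw [Set.indicator_of_mem (show W ∈ {W : Set V | a₃ ∈ W} from hW),
      Set.indicator_of_mem (show W' ∈ {W : Set V | a₃ ∈ W} from hW')]
    simp only [Pi.one_apply, one_mul]
    have := hgo hWW'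
    nlinarith [this, hD]
  · have h0 : phi p ends o a₁ a₂ a₃ W = 0 := by
      unfold phi indS
      rw [Set.indicator_of_notMem (show W ∉ {W : Set V | a₃ ∈ W} from hW), zero_mul]
    simp only [h0, neg_zero]
    exact neg_phi_nonneg_of_regime p ends o a₁ a₂ a₃ hreg W'

omit [Fintype V] [DecidableEq V] in
/-- `1[x ∈ ·]` is increasing. -/
lemma indS_monotone (x : V) : Monotone (fun W : Set V => (indS x W : R)) := by
  intro W W' hWW'
  show (indS x W : R) ≤ indS x W'
  unfold indS
  by_cases hW : x ∈ W
  · have hW' : x ∈ W' := hWW' hW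
    rw [Set.indicator_of_mem (show W ∈ {W : Set V | x ∈ W} from hW),
      Set.indicator_of_mem (show W' ∈ {W : Set V | x ∈ W} from hW')]
    simp only [Pi.one_apply, le_refl]
  · rw [Set.indicator_of_notMem (show W ∉ {W : Set V | x ∈ W} from hW)]
    exact Set.indicator_apply_nonneg fun _ => zero_le_one

/-- **BHK06 Thm 1.3 on `C₁` avoiding `a₂`, cleared**: for increasing nonnegative `F₁, F₂`,
`E[F₁ 1_Q]·E[F₂ 1_Q] ≤ E[F₁ F₂ 1_Q]·P(Q)`, i.e. `0 ≤ covS F₁ F₂`. -/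
theorem covS_nonneg_of_monotone (hp : IsProbVec p) {F₁ F₂ : Set V → R} (hF₁ : Monotone F₁)
    (hF₂ : Monotone F₂) (hF₁0 : ∀ S, 0 ≤ F₁ S) (hF₂0 : ∀ S, 0 ≤ F₂ S) :
    0 ≤ covS p ends a₁ a₂ F₁ F₂ := by
  have h := bhk_induced p hp ends a₁ hF₁ hF₂ hF₁0 hF₂0 Finset.univ {a₂} {a₂} (Finset.subset_univ _)
    (Finset.subset_univ _)
  rw [Finset.inter_self, Finset.union_self, REvent_univ_singleton,
    CovForm.compl_connEvent_eq_Q ends a₁ a₂] at h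
  change expect p (fun ω => clusterObs ends Finset.univ a₁ F₁ ω * 𝟙Q ω) *
      expect p (fun ω => clusterObs ends Finset.univ a₁ F₂ ω * 𝟙Q ω) ≤
    expect p (fun ω => clusterObs ends Finset.univ a₁ (F₁ * F₂) ω * 𝟙Q ω) * prob p Q at h
  simp only [clusterObs_apply, clusterIn_univ, Pi.mul_apply] at h
  unfold covS
  linarith

omit [Fintype V] [DecidableEq V] [LinearOrder R] [IsStrictOrderedRing R] in
/-- `covS` is linear in its second argument: `covS F (−G) = −covS F G`. -/
lemma covS_neg_right (F G : Set V → R) :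
    covS p ends a₁ a₂ F (fun W => -G W) = -covS p ends a₁ a₂ F G := by
  unfold covS
  have e1 : expect p (fun ω => F (cluster ends ω a₁) * -G (cluster ends ω a₁) * 𝟙Q ω) =
      -expect p (fun ω => F (cluster ends ω a₁) * G (cluster ends ω a₁) * 𝟙Q ω) := by
    rw [show (fun ω => F (cluster ends ω a₁) * -G (cluster ends ω a₁) * 𝟙Q ω) =
        fun ω => (-1 : R) * (F (cluster ends ω a₁) * G (cluster ends ω a₁) * 𝟙Q ω) from by
      funext ω; ring]
    rw [expect_const_mul]; ring
  have e2 : expect p (fun ω => -G (cluster ends ω a₁) * 𝟙Q ω) =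
      -expect p (fun ω => G (cluster ends ω a₁) * 𝟙Q ω) := by
    rw [show (fun ω => -G (cluster ends ω a₁) * 𝟙Q ω) =
        fun ω => (-1 : R) * (G (cluster ends ω a₁) * 𝟙Q ω) from by funext ω; ring]
    rw [expect_const_mul]; ring
  rw [e1, e2]
  ring

omit [Fintype V] [DecidableEq V] [LinearOrder R] [IsStrictOrderedRing R] in
/-- `covS (1 − F) G = −covS F G`: the constant functional `1` has zero covariance with everything. -/
lemma covS_one_sub_left (F G : Set V → R) :
    covS p ends a₁ a₂ (fun W => 1 - F W) G = -covS p ends a₁ a₂ F G := by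
  unfold covS
  have e1 : expect p (fun ω => (1 - F (cluster ends ω a₁)) * G (cluster ends ω a₁) * 𝟙Q ω) =
      expect p (fun ω => G (cluster ends ω a₁) * 𝟙Q ω) -
        expect p (fun ω => F (cluster ends ω a₁) * G (cluster ends ω a₁) * 𝟙Q ω) := by
    rw [← expect_sub]; congr 1; funext ω; simp only [Pi.sub_apply]; ring
  have e2 : expect p (fun ω => (1 - F (cluster ends ω a₁)) * 𝟙Q ω) =
      prob p Q - expect p (fun ω => F (cluster ends ω a₁) * 𝟙Q ω) := by
    rw [prob_eq_expect_indicator, ← expect_sub]; congr 1; funext ω; simp only [Pi.sub_apply]; ring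
  rw [e1, e2]
  ring

/-- **(i) in the pointwise regime, at `S`-level**: `covS (1[b ∈ ·]) φ ≤ 0` — `Cov(incr, incr) ≥ 0`
for `1[b ∈ S]` and `−φ`. -/
theorem covS_indS_phi_nonpos_of_regime (hp : IsProbVec p)
    (hreg : ∀ W : Set V, a₃ ∈ W → D * hS p ends a₂ o W ≤ Dₒ) :
    covS p ends a₁ a₂ (indS b) (phi p ends o a₁ a₂ a₃) ≤ 0 := by
  have h := covS_nonneg_of_monotone p ends a₁ a₂ hp (indS_monotone b)
    (neg_phi_monotone_of_regime p ends o a₁ a₂ a₃ hp hreg) (fun S => indS_nonneg b S)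
    (neg_phi_nonneg_of_regime p ends o a₁ a₂ a₃ hreg)
  rw [covS_neg_right] at h
  linarith

/-- **(SC) in the pointwise regime, at `S`-level**: `0 ≤ covS h_b φ` — `Cov(decr, incr) ≤ 0` for `h_b`
and `−φ`, via `1 − h_b` increasing. -/
theorem covS_hS_phi_nonneg_of_regime (hp : IsProbVec p)
    (hreg : ∀ W : Set V, a₃ ∈ W → D * hS p ends a₂ o W ≤ Dₒ) :
    0 ≤ covS p ends a₁ a₂ (hS p ends a₂ b) (phi p ends o a₁ a₂ a₃) := by
  have hgb : Antitone (hS p ends a₂ b) := delClusterProb_anti p hp ends a₂ (isUpperSet_mem_setOf b)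
  have hF₁ : Monotone (fun W : Set V => 1 - hS p ends a₂ b W) := fun W W' h => by
    show 1 - hS p ends a₂ b W ≤ 1 - hS p ends a₂ b W'
    linarith [hgb h]
  have hF₁0 : ∀ W : Set V, 0 ≤ 1 - hS p ends a₂ b W := fun W => by
    have := delClusterProb_le_one p hp ends a₂ {W : Set V | b ∈ W} W
    unfold hS
    linarith
  have h := covS_nonneg_of_monotone p ends a₁ a₂ hp hF₁
    (neg_phi_monotone_of_regime p ends o a₁ a₂ a₃ hp hreg) hF₁0
    (neg_phi_nonneg_of_regime p ends o a₁ a₂ a₃ hreg)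
  rw [covS_neg_right, covS_one_sub_left] at h
  linarith

/-- **(ii) = (RV) in table form, in the pointwise regime** — through the `S`-level decomposition
(a second proof of `J1RV.rvTable_of_regime`: Harris term `≥ 0` + (SC) in the regime). -/
theorem rvTable_of_regime' (hp : IsProbVec p)
    (hreg : ∀ W : Set V, a₃ ∈ W → D * hS p ends a₂ o W ≤ Dₒ) :
    J1RV.RVTable p ends o a₁ a₂ a₃ b :=
  rvTable_of_covS_nonneg p ends o a₁ a₂ a₃ b hp (covS_hS_phi_nonneg_of_regime p ends o a₁ a₂ a₃ b hp hreg)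

end Regime

section Split

variable {V : Type*} {E : Type*} [Fintype E] [DecidableEq E] [Fintype V] [DecidableEq V]
  {R : Type*} [Field R] [LinearOrder R] [IsStrictOrderedRing R]

variable (p : E → R) (ends : E → Sym2 V) (o a₁ a₂ a₃ b : V)

local notation3 "D" => prob p (PDEvent ends a₁ a₂ a₃)
local notation3 "Dₒ" => CovForm.Do p ends o a₁ a₂ a₃

/-- The GOOD part of the jump functional: `φ⁺ᵍ(S) = e(S) · max (D_o − D h_o(S)) 0 = (−φ)⁺` — increasing and
nonnegative on EVERY instance (no regime hypothesis). -/
noncomputable def phiGood (S : Set V) : R :=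
  indS a₃ S * max (Dₒ - D * hS p ends a₂ o S) 0

/-- The BAD part of the jump functional: `φᵇ(S) = e(S) · max (D h_o(S) − D_o) 0 = φ⁺`, carried by the
`o`-rich hosts `{S ∋ a₃ : h_o(S) > γ}`; `φ = φᵇ − φᵍ` pointwise. -/
noncomputable def phiBad (S : Set V) : R :=
  indS a₃ S * max (D * hS p ends a₂ o S - Dₒ) 0

omit [Fintype V] [DecidableEq V] in
/-- `φ = φᵇ − φᵍ` pointwise. -/
lemma phi_eq_bad_sub_good (S : Set V) :
    phi p ends o a₁ a₂ a₃ S = phiBad p ends o a₁ a₂ a₃ S - phiGood p ends o a₁ a₂ a₃ S := by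
  unfold phi phiBad phiGood
  rw [← mul_sub]
  congr 1
  rcases le_total (D * hS p ends a₂ o S) Dₒ with h | h
  · rw [max_eq_right (by linarith), max_eq_left (by linarith)]; ring
  · rw [max_eq_left (by linarith), max_eq_right (by linarith)]; ring

omit [Fintype V] [DecidableEq V] in
/-- `0 ≤ φᵍ`. -/
lemma phiGood_nonneg (S : Set V) : 0 ≤ phiGood p ends o a₁ a₂ a₃ S :=
  mul_nonneg (indS_nonneg a₃ S) (le_max_right _ _)

omit [Fintype V] [DecidableEq V] in
/-- `φᵍ` is increasing on every instance: `h_o` is antitone, so `max (D_o − D h_o) 0` is monotone, and the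
indicator jumps from `0` to a nonnegative value. -/
lemma phiGood_monotone (hp : IsProbVec p) : Monotone (phiGood p ends o a₁ a₂ a₃) := by
  have hgo : Antitone (hS p ends a₂ o) := delClusterProb_anti p hp ends a₂ (isUpperSet_mem_setOf o)
  have hD : 0 ≤ D := prob_nonneg hp _
  intro W W' hWW'
  unfold phiGood indS
  by_cases hW : a₃ ∈ W
  · have hW' : a₃ ∈ W' := hWW' hW
    rw [Set.indicator_of_mem (show W ∈ {W : Set V | a₃ ∈ W} from hW),
      Set.indicator_of_mem (show W' ∈ {W : Set V | a₃ ∈ W} from hW')]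
    simp only [Pi.one_apply, one_mul]
    have := hgo hWW'
    exact max_le_max (by nlinarith [this, hD]) le_rfl
  · rw [Set.indicator_of_notMem (show W ∉ {W : Set V | a₃ ∈ W} from hW), zero_mul]
    exact mul_nonneg (Set.indicator_apply_nonneg fun _ => zero_le_one) (le_max_right _ _)

/-- **The unconditional good part of (i)**: `0 ≤ covS (1[b ∈ ·]) φᵍ` on every instance (BHK 1.3). -/
theorem covS_indS_phiGood_nonneg (hp : IsProbVec p) :
    0 ≤ covS p ends a₁ a₂ (indS b) (phiGood p ends o a₁ a₂ a₃) :=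
  covS_nonneg_of_monotone p ends a₁ a₂ hp (indS_monotone b) (phiGood_monotone p ends o a₁ a₂ a₃ hp)
    (fun S => indS_nonneg b S) (phiGood_nonneg p ends o a₁ a₂ a₃)

/-- **The unconditional good part of (SC)**: `covS h_b φᵍ ≤ 0` on every instance (BHK 1.3 via `1 − h_b`). -/
theorem covS_hS_phiGood_nonpos (hp : IsProbVec p) :
    covS p ends a₁ a₂ (hS p ends a₂ b) (phiGood p ends o a₁ a₂ a₃) ≤ 0 := by
  have hgb : Antitone (hS p ends a₂ b) := delClusterProb_anti p hp ends a₂ (isUpperSet_mem_setOf b)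
  have hF₁ : Monotone (fun W : Set V => 1 - hS p ends a₂ b W) := fun W W' h => by
    show 1 - hS p ends a₂ b W ≤ 1 - hS p ends a₂ b W'
    linarith [hgb h]
  have hF₁0 : ∀ W : Set V, 0 ≤ 1 - hS p ends a₂ b W := fun W => by
    have := delClusterProb_le_one p hp ends a₂ {W : Set V | b ∈ W} W
    unfold hS
    linarith
  have h := covS_nonneg_of_monotone p ends a₁ a₂ hp hF₁ (phiGood_monotone p ends o a₁ a₂ a₃ hp) hF₁0
    (phiGood_nonneg p ends o a₁ a₂ a₃)
  rw [covS_one_sub_left] at h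
  linarith

omit [Fintype V] [DecidableEq V] [LinearOrder R] [IsStrictOrderedRing R] in
/-- `covS` is additive in its second argument: `covS F (G₁ − G₂) = covS F G₁ − covS F G₂`. -/
lemma covS_sub_right (F G₁ G₂ : Set V → R) :
    covS p ends a₁ a₂ F (fun W => G₁ W - G₂ W) = covS p ends a₁ a₂ F G₁ - covS p ends a₁ a₂ F G₂ := by
  unfold covS
  have e1 : expect p (fun ω => F (cluster ends ω a₁) * (G₁ (cluster ends ω a₁) - G₂ (cluster ends ω a₁)) *
      (avoidAll ends a₂ {a₁}).indicator 1 ω) =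
      expect p (fun ω => F (cluster ends ω a₁) * G₁ (cluster ends ω a₁) *
        (avoidAll ends a₂ {a₁}).indicator 1 ω) -
      expect p (fun ω => F (cluster ends ω a₁) * G₂ (cluster ends ω a₁) *
        (avoidAll ends a₂ {a₁}).indicator 1 ω) := by
    rw [← expect_sub]; congr 1; funext ω; simp only [Pi.sub_apply]; ring
  have e2 : expect p (fun ω => (G₁ (cluster ends ω a₁) - G₂ (cluster ends ω a₁)) *
      (avoidAll ends a₂ {a₁}).indicator 1 ω) =
      expect p (fun ω => G₁ (cluster ends ω a₁) * (avoidAll ends a₂ {a₁}).indicator 1 ω) -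
      expect p (fun ω => G₂ (cluster ends ω a₁) * (avoidAll ends a₂ {a₁}).indicator 1 ω) := by
    rw [← expect_sub]; congr 1; funext ω; simp only [Pi.sub_apply]; ring
  rw [e1, e2]
  ring

omit [Fintype V] [DecidableEq V] in
/-- The good/bad split of any `S`-covariance with `φ`: `covS F φ = covS F φᵇ − covS F φᵍ`. -/
theorem covS_phi_split (F : Set V → R) :
    covS p ends a₁ a₂ F (phi p ends o a₁ a₂ a₃) =
      covS p ends a₁ a₂ F (phiBad p ends o a₁ a₂ a₃) - covS p ends a₁ a₂ F (phiGood p ends o a₁ a₂ a₃) := by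
  rw [← covS_sub_right]
  congr 1
  funext S
  exact phi_eq_bad_sub_good p ends o a₁ a₂ a₃ S

omit [Fintype V] [DecidableEq V] in
/-- **The open content of (i) at `S`-level**: (i) `⟺ covS (1[b ∈ ·]) φᵇ ≤ covS (1[b ∈ ·]) φᵍ` — the bad
(`o`-rich-host) covariance is dominated by the PA good part (`≥ 0` by `covS_indS_phiGood_nonneg`). -/
theorem i_iff_bad_le_good :
    covS p ends a₁ a₂ (indS b) (phi p ends o a₁ a₂ a₃) ≤ 0 ↔
      covS p ends a₁ a₂ (indS b) (phiBad p ends o a₁ a₂ a₃) ≤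
        covS p ends a₁ a₂ (indS b) (phiGood p ends o a₁ a₂ a₃) := by
  rw [covS_phi_split]
  exact sub_nonpos

omit [Fintype V] [DecidableEq V] in
/-- **The open content of (SC) at `S`-level**: (SC) `⟺ covS h_b φᵍ ≤ covS h_b φᵇ` — the good part is
`≤ 0` by `covS_hS_phiGood_nonpos`; (SC) asks that the bad part be no smaller. -/
theorem sc_iff_good_le_bad :
    0 ≤ covS p ends a₁ a₂ (hS p ends a₂ b) (phi p ends o a₁ a₂ a₃) ↔
      covS p ends a₁ a₂ (hS p ends a₂ b) (phiGood p ends o a₁ a₂ a₃) ≤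
        covS p ends a₁ a₂ (hS p ends a₂ b) (phiBad p ends o a₁ a₂ a₃) := by
  rw [covS_phi_split]
  exact sub_nonneg

end Split

end SLevel

end Summit.Ventures.PercRepro2
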